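import Summits.KontsevichZagierPeriods.KontsevichZagierPeriods.Theorems.SymplecticScissorsRealOnePeriodRelationsStubSaPathSubsetAux

/-!
# `RealOnePeriodRelations` (stmt-KontsevichZagierPeriods-10042, route SymplecticScissors), line
# `nash-retraction-thin-strip`: stub `stub_saPathSubset` — semialgebraic `C¹` paths inside an open set

Given, at every point of a smooth affine curve `Z ⊂ ℂⁿ` over `ℚ̄`, a holomorphic graph chart `ψ`
over a coordinate `i₀` which is a `ℚ`-SEMIALGEBRAIC map (realified, `ℂ = ℝ²`, `ℂⁿ = ℝ²ⁿ`) on a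
closed disc `closedBall c ρ` around the chart coordinate of the point, a continuous path
`e : [0,1] → Z(ℂ) ∩ G` (`G ⊂ ℂⁿ` open) with ALGEBRAIC end points is replaced by a `C¹` path on `Z`
(a `CurvePeriods.CurvePath`) with the same end points, inside `G`, whose realification is a
`ℚ`-semialgebraic map on `[0,1]`. This is the tree's `CurvePeriods.exists_curvePath_subset`
(Huber–Wüstholz 2022, §3.3.1: singular `1`-chains may be taken smooth) with the semialgebraicity
bookkeeping added: `[0,1]` is cut into `N` pieces each mapped by `e` into one chart region inside
`G` (Lebesgue number), the break points `e(r/N)` are moved to nearby ALGEBRAIC points of `Z`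
(`CurveData.IsSmoothAffineCurve.exists_algebraicPoint_mem`), consecutive ones are joined by the
chart-straight paths `ψ((1 − t) b_r + t b_{r+1})` (`CurvePeriods.chartSegment`; semialgebraic since
`ψ` is semialgebraic on the closed disc and `b_r ∈ ℚ̄`), and the pieces are concatenated by
`CurvePeriods.CurvePath.concat`, whose reparametrisation is the flat cubic `3s² − 2s³` — a
polynomial, so concatenation preserves semialgebraicity (Bochnak–Coste–Roy 1998, Prop. 2.2.6:
compositions and finite unions of graphs). The semialgebraicity of the three path constructions
(`SaPathSubset.sa_const`, `SaPathSubset.sa_chartSegment`, `helper_saPathSubset_1` for `concat`) and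
the chart pieces inside `G` (`SaPathSubset.exists_chart_subset`) are in the auxiliary file
`Theorems/SymplecticScissorsRealOnePeriodRelationsStubSaPathSubsetAux.lean`.

References: A. Huber, G. Wüstholz, *Transcendence and Linear Relations of 1-Periods* (CUP 2022),
§3.3.1; J. Bochnak, M. Coste, M.-F. Roy, *Real Algebraic Geometry* (1998), §2.2;
M. Kontsevich, D. Zagier, *Periods* (2001), §1.1.
-/

noncomputable section

open scoped BigOperators Topology
open Set Filter MvPolynomial
open Literature.NumberTheory.Transcendental Literature.NumberTheory.Transcendental.CurvePeriods
open Literature.ModelTheory.ExponentialFields (IsSemialgebraic)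

namespace Summit.KontsevichZagierPeriods.SymplecticScissors.RealOnePeriodRelations

open SaPathSubset in
/-- **Semialgebraic `C¹` paths inside an open set** (registered stub `stub_saPathSubset` of crux
stmt-KontsevichZagierPeriods-10042). Given semialgebraic graph charts of smooth affine curves over
`ℚ̄` (hypothesis), a continuous path `e : [0,1] → Z(ℂ) ∩ G`, `G ⊂ ℂⁿ` open, with ALGEBRAIC end
points is replaced by a `C¹` path on `Z` (a `CurvePath`) with the same end points, `γ([0,1]) ⊆ G`,
whose realification is a `ℚ`-semialgebraic map on `[0,1]`: cover the path by chart pieces inside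
`G`, cut `[0,1]` into `N` pieces each mapped into one piece (Lebesgue number), replace the break
points by nearby algebraic points of `Z` (`Z(ℚ̄)` is dense), join consecutive ones by
chart-straight paths and concatenate with the flat cubic `3s² − 2s³`; constants, chart segments
and concatenations are semialgebraic (`sa_const`, `sa_chartSegment`, `helper_saPathSubset_1` of
the auxiliary file).
[cite: HuberWustholz2022, §3.3.1] -/
theorem stub_saPathSubset :
    (∀ (Z : CurveData), Z.IsSmoothAffineCurve → ∀ z₀ ∈ Z.points,
      ∃ (i₀ : Fin Z.n) (c : ℂ) (ε ρ : ℝ) (Ω : Set (Fin Z.n → ℂ)) (ψ : ℂ → (Fin Z.n → ℂ)),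
        0 < ρ ∧ ρ < ε ∧ IsOpen Ω ∧ z₀ ∈ Ω ∧ z₀ i₀ ∈ Metric.ball c (ρ / 6) ∧ AnalyticOnNhd ℂ ψ (Metric.ball c ε) ∧
        (∀ z ∈ Ω, z ∈ Z.points → z i₀ ∈ Metric.ball c ε ∧ ψ (z i₀) = z) ∧
        (∀ w ∈ Metric.ball c ε, ψ w ∈ Ω ∧ ψ w ∈ Z.points ∧ ψ w i₀ = w) ∧
        IsSemialgebraicMapOn ℚ {q : Fin 2 → ℝ | (⟨q 0, q 1⟩ : ℂ) ∈ Metric.closedBall c ρ}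
          (fun q => Fin.append (fun i => (ψ ⟨q 0, q 1⟩ i).re) (fun i => (ψ ⟨q 0, q 1⟩ i).im))) →
    ∀ (Z : CurveData), Z.IsSmoothAffineCurve → ∀ (G : Set (Fin Z.n → ℂ)), IsOpen G →
    ∀ (e : ℝ → (Fin Z.n → ℂ)), ContinuousOn e (Set.Icc 0 1) →
      (∀ t ∈ Set.Icc (0 : ℝ) 1, e t ∈ Z.points) → (∀ t ∈ Set.Icc (0 : ℝ) 1, e t ∈ G) →
      (∀ i, IsAlgebraic ℚ (e 0 i)) → (∀ i, IsAlgebraic ℚ (e 1 i)) →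
    ∃ γ : CurvePath Z,
      IsSemialgebraicMapOn ℚ {z : Fin 1 → ℝ | z 0 ∈ Set.Icc (0 : ℝ) 1}
        (fun z => Fin.append (fun i => (γ.toFun (z 0) i).re) (fun i => (γ.toFun (z 0) i).im)) ∧
      γ.toFun 0 = e 0 ∧ γ.toFun 1 = e 1 ∧ ∀ t ∈ Set.Icc (0 : ℝ) 1, γ.toFun t ∈ G := by
  intro H Z hZ G hG c hc hcZ hcG hp hq
  classical
  have hI0 : (0 : ℝ) ∈ Icc (0 : ℝ) 1 := ⟨le_rfl, zero_le_one⟩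
  have hI1 : (1 : ℝ) ∈ Icc (0 : ℝ) 1 := ⟨zero_le_one, le_rfl⟩
  -- semialgebraic chart pieces inside `G` at the points of `Z ∩ G`
  haveI : Nonempty (Fin Z.n) :=
    ⟨⟨0, Nat.pos_of_ne_zero (n_ne_zero_of_mem hZ (hcZ 0 hI0))⟩⟩
  choose! i₀ T Ω ψ ctr ρ hT hΩo hxΩ hψ h1 hψZ hψG hTρ hSA using
    fun x (hx : x ∈ Z.points ∩ G) => exists_chart_subset H hZ hG hx
  -- an open cover of `[0,1]` in `ℝ` by preimages of the chart domains
  have hcov : ∀ s : Icc (0 : ℝ) 1, ∃ U : Set ℝ, IsOpen U ∧ (s : ℝ) ∈ U ∧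
      ∀ t ∈ U, t ∈ Icc (0 : ℝ) 1 → c t ∈ Ω (c s) := by
    intro s
    have hs : c s ∈ Z.points ∩ G := ⟨hcZ s s.2, hcG s s.2⟩
    obtain ⟨U, hUo, hU⟩ := (_root_.continuousOn_iff'.mp hc) (Ω (c s)) (hΩo _ hs)
    refine ⟨U, hUo, ?_, fun t htU ht => ?_⟩
    · have : (s : ℝ) ∈ c ⁻¹' Ω (c s) ∩ Icc (0 : ℝ) 1 := ⟨hxΩ _ hs, s.2⟩
      rw [hU] at this
      exact this.1
    · have : t ∈ U ∩ Icc (0 : ℝ) 1 := ⟨htU, ht⟩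
      rw [← hU] at this
      exact this.1
  choose U hUo hsU hU using hcov
  obtain ⟨δ, hδ, hleb⟩ := lebesgue_number_lemma_of_metric isCompact_Icc hUo
    (fun t ht => mem_iUnion.mpr ⟨⟨t, ht⟩, hsU ⟨t, ht⟩⟩)
  -- the subdivision `t_r = r / N`
  obtain ⟨N₀, hN₀⟩ := exists_nat_one_div_lt hδ
  set N : ℕ := N₀ + 1 with hN
  have hNpos : (0 : ℝ) < N := by rw [hN]; positivity
  have htI : ∀ r : ℕ, r ≤ N → (r : ℝ) / N ∈ Icc (0 : ℝ) 1 := fun r hr =>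
    ⟨by positivity, (div_le_one hNpos).mpr (by exact_mod_cast hr)⟩
  -- the chart of the `r`-th piece
  have hidx : ∀ r : ℕ, r < N → ∃ s : Icc (0 : ℝ) 1, ∀ t ∈ Icc ((r : ℝ) / N) ((r + 1 : ℝ) / N),
      c t ∈ Ω (c s) := by
    intro r hr
    obtain ⟨s, hs⟩ := hleb ((r : ℝ) / N) (htI r hr.le)
    refine ⟨s, fun t ht => hU s t (hs ?_) ⟨(htI r hr.le).1.trans ht.1, ht.2.trans ?_⟩⟩
    · rw [Metric.mem_ball, Real.dist_eq, abs_lt]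
      have hNinv : 1 / (N : ℝ) < δ := by rw [hN]; exact_mod_cast hN₀
      constructor
      · have : (0 : ℝ) ≤ t - r / N := sub_nonneg.mpr ht.1
        linarith
      · have h1 : t - r / N ≤ 1 / N := by
          have := ht.2
          rw [add_div] at this
          linarith
        linarith
    · rw [div_le_one hNpos]
      exact_mod_cast hr
  choose! s hs using hidx
  -- chart data of piece `r`: base point `x r = c (s r)`
  set x : ℕ → (Fin Z.n → ℂ) := fun r => c (s r) with hx
  have hxZG : ∀ r, x r ∈ Z.points ∩ G := fun r => ⟨hcZ _ (s r).2, hcG _ (s r).2⟩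
  have hcΩ : ∀ r, r < N → ∀ t ∈ Icc ((r : ℝ) / N) ((r + 1 : ℝ) / N), c t ∈ Ω (x r) :=
    fun r hr t ht => hs r hr t ht
  -- end points of piece `r` lie in its chart domain
  have hleft : ∀ r, r < N → c ((r : ℝ) / N) ∈ Ω (x r) := fun r hr =>
    hcΩ r hr _ ⟨le_rfl, by gcongr; linarith⟩
  have hright : ∀ r, r < N → c ((r + 1 : ℝ) / N) ∈ Ω (x r) := fun r hr =>
    hcΩ r hr _ ⟨by gcongr; linarith, le_rfl⟩
  -- algebraic break points `p r`, `0 ≤ r ≤ N`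
  have hpts : ∀ r : ℕ, ∃ p : Fin Z.n → ℂ, p ∈ Z.points ∧ (∀ i, IsAlgebraic ℚ (p i)) ∧
      (r = 0 → p = c 0) ∧ (r = N → p = c 1) ∧ (r < N → p ∈ Ω (x r)) ∧
      (0 < r → r ≤ N → p ∈ Ω (x (r - 1))) := by
    intro r
    rcases Nat.eq_zero_or_pos r with h0 | hpos
    · subst h0
      refine ⟨c 0, hcZ 0 hI0, hp, fun _ => rfl, fun h => absurd h (by rw [hN]; omega),
        fun hr => ?_, fun h => absurd h (lt_irrefl 0)⟩
      have := hleft 0 hr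
      rwa [Nat.cast_zero, zero_div] at this
    rcases lt_trichotomy r N with hlt | heq | hgt
    · -- interior break point: an algebraic point of `Z` in the overlap of two charts
      have hr1 : r - 1 < N := by omega
      have hmem : c ((r : ℝ) / N) ∈ Ω (x (r - 1)) ∩ Ω (x r) := by
        refine ⟨?_, hleft r hlt⟩
        have := hright (r - 1) hr1
        have hcast : ((r - 1 : ℕ) : ℝ) + 1 = r := by
          rw [Nat.cast_sub (by omega : 1 ≤ r)]
          push_cast
          ring
        rwa [hcast] at this
      obtain ⟨p, hpO, hpZ, hpa⟩ := hZ.exists_algebraicPoint_mem (hcZ _ (htI r hlt.le))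
        ((hΩo _ (hxZG _)).inter (hΩo _ (hxZG _))) hmem
      exact ⟨p, hpZ, hpa, fun h => absurd h (by omega), fun h => absurd h (by omega),
        fun _ => hpO.2, fun _ _ => hpO.1⟩
    · subst heq
      refine ⟨c 1, hcZ 1 hI1, hq, fun h => absurd h (by rw [hN]; omega), fun _ => rfl,
        fun h => absurd h (lt_irrefl _), fun _ _ => ?_⟩
      have := hright (N - 1) (by omega)
      have hcast : ((N - 1 : ℕ) : ℝ) + 1 = N := by
        rw [Nat.cast_sub (by omega : 1 ≤ N)]
        push_cast
        ring
      rwa [hcast, div_self hNpos.ne'] at this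
    · exact ⟨c 0, hcZ 0 hI0, hp, fun h => absurd h (by omega), fun h => absurd h (by omega),
        fun h => absurd h (by omega), fun _ h => absurd h (by omega)⟩
  choose p hpZ hpa hp0 hpN hpΩ hpΩ' using hpts
  -- the chart-straight pieces and their concatenation, by induction on `r`
  have hind : ∀ r : ℕ, r ≤ N → ∃ γ : CurvePath Z,
      IsSemialgebraicMapOn ℚ {z : Fin 1 → ℝ | z 0 ∈ Set.Icc (0 : ℝ) 1}
        (fun z => Fin.append (fun i => (γ.toFun (z 0) i).re) (fun i => (γ.toFun (z 0) i).im)) ∧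
      γ.toFun 0 = p 0 ∧ γ.toFun 1 = p r ∧ ∀ t ∈ Icc (0 : ℝ) 1, γ.toFun t ∈ G := by
    intro r
    induction r with
    | zero =>
      intro _
      refine ⟨CurvePath.const (p 0) (hpZ 0) (hpa 0), sa_const (p 0) (hpZ 0) (hpa 0), rfl, rfl,
        fun t _ => ?_⟩
      show p 0 ∈ G
      rw [hp0 0 rfl]
      exact hcG 0 hI0
    | succ r ih =>
      intro hr
      have hrN : r < N := Nat.lt_of_succ_le hr
      obtain ⟨γ, hγSA, hγ0, hγ1, hγG⟩ := ih hrN.le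
      -- the piece from `p r` to `p (r + 1)` in chart `r`
      have hb₀ := h1 _ (hxZG r) (p r) (hpΩ r hrN) (hpZ r)
      have hb₁ := h1 _ (hxZG r) (p (r + 1)) (hpΩ' (r + 1) (Nat.succ_pos r) hr) (hpZ (r + 1))
      have ha₀ : ∀ i, IsAlgebraic ℚ (ψ (x r) (p r (i₀ (x r))) i) := fun i => by
        rw [hb₀.2]; exact hpa r i
      have ha₁ : ∀ i, IsAlgebraic ℚ (ψ (x r) (p (r + 1) (i₀ (x r))) i) := fun i => by
        rw [hb₁.2]; exact hpa (r + 1) i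
      let σ : CurvePath Z :=
        chartSegment (hT _ (hxZG r)) (hψ _ (hxZG r)) (hψZ _ (hxZG r)) _ _ hb₀.1 hb₁.1 ha₀ ha₁
      have hσ0 : σ.toFun 0 = p r := by
        show ψ (x r) (segPoint (p r (i₀ (x r))) (p (r + 1) (i₀ (x r))) 0) = p r
        rw [segPoint_zero, hb₀.2]
      have hσ1 : σ.toFun 1 = p (r + 1) := by
        show ψ (x r) (segPoint (p r (i₀ (x r))) (p (r + 1) (i₀ (x r))) 1) = p (r + 1)
        rw [segPoint_one, hb₁.2]
      have hσG : ∀ t ∈ Icc (0 : ℝ) 1, σ.toFun t ∈ G := fun t ht =>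
        hψG _ (hxZG r) (segPoint_mem (hT _ (hxZG r)) hb₀.1 hb₁.1 ht)
      have hσSA : IsSemialgebraicMapOn ℚ {z : Fin 1 → ℝ | z 0 ∈ Set.Icc (0 : ℝ) 1}
          (fun z => Fin.append (fun i => (σ.toFun (z 0) i).re) (fun i => (σ.toFun (z 0) i).im)) :=
        sa_chartSegment (hSA _ (hxZG r)) (hTρ _ (hxZG r) hb₀.1) (hTρ _ (hxZG r) hb₁.1)
          (hpa r (i₀ (x r))) (hpa (r + 1) (i₀ (x r)))
      have hj : γ.toFun 1 = σ.toFun 0 := by rw [hγ1, hσ0]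
      refine ⟨γ.concat σ hj, helper_saPathSubset_1 γ σ hj hγSA hσSA, ?_, ?_,
        fun t ht => CurvePath.concat_mem γ σ hj hγG hσG t ht⟩
      · rw [CurvePath.concat_zero, hγ0]
      · rw [CurvePath.concat_one, hσ1]
  obtain ⟨γ, hγSA, hγ0, hγ1, hγG⟩ := hind N le_rfl
  exact ⟨γ, hγSA, by rw [hγ0, hp0 0 rfl], by rw [hγ1, hpN N rfl], hγG⟩

end Summit.KontsevichZagierPeriods.SymplecticScissors.RealOnePeriodRelations

end
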